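import Literature.AlgebraicGeometry.Resolution.KnafKuhlmann2009HenselianRationalityEtale
import Mathlib.RingTheory.DedekindDomain.Different
import Mathlib.RingTheory.Valuation.LocalSubring
import HarnessLib

/-!
# Valuation rings of inertially generated extensions: `O_{L(η)} = (O_L[η])_q` (Knaf–Kuhlmann 2009, Lemma 3.7)

Topic: `Literature/AlgebraicGeometry/Resolution` (valued function fields). A PROVED structure
theorem serving the decomposition of the named facts `KnafKuhlmann2009_Thm12` /
`KnafKuhlmann2009` (Knaf–Kuhlmann 2009, Thm. 1.2), whose frontier consists of the two
"elimination of ramification" facts `KnafKuhlmann2009_Thm38_Lemma37_sepClosed` (henselian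
rationality, [K8]) and `KnafKuhlmann2005_Thm34_etale` (inertial generation of Abhyankar places,
via the Generalized Stability Theorem), both of which end with the local-étale structure of `O_F`
over `O_{K(T)}`
(Knaf–Kuhlmann 2009, Lemma 3.7 (2), (3): "`P` is strongly smoothly `O_L`-uniformizable iff
`O_P|O_L` is local-étale"; "`O_P|O_L` is local-étale iff `(F,P)` lies in the absolute inertia field
of `(L,P)`", [Ray] X Thm. 1; Knaf–Kuhlmann 2005, §5: "`O_F = A_q` for an étale `O_E`-algebra `A`").
This file proves that structure from the elementary hypothesis by which both sources produce it
— a generator `η` of `F = L(η)` whose minimal polynomial `f` over `L` has coefficients in `O_L` and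
satisfies `v(f'(η)) = 0` (a *henselian element* of F.-V. Kuhlmann, J. Novacoski, *Henselian
elements*, J. Algebra 418 (2014); [K8] p. 14) —:

* `exists_div_of_valuation_derivative_eq_one` — **`O_{L(η)} = (O_L[η])_q`**: every `z ∈ V ∩ L(η)`
  is `a(η)/b(η)` with `a, b` polynomials over `O_L = V ∩ L` and `v(b(η)) = 0` (multiplicatively:
  `= 1`). PROVED.

The proof is the classical one, in two halves, both elementary given Mathlib:

* (`exists_div_of_valuativelyClosed`) **the valuation rings of an algebraic extension `F|L`
  over `O_L` are localisations of the integral closure `N` of `O_L` in `F`** (Bourbaki, *Algèbre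
  commutative* VI §8 no. 6), elementwise and valuatively: `N` is taken as the set of elements of `F`
  lying in every valuation ring `W ⊇ O_L` of `Ω` (= the integral closure, by Chevalley's extension
  theorem, Mathlib's `Subring.exists_le_valuationSubring_of_isIntegrallyClosedIn`); for `z ∈ V ∩ F`
  an algebraic relation `∑ aᵢ zⁱ = 0` over `O_L` with a unit coefficient has truncations
  `T_j = ∑_{m} a_{j+m} z^m ∈ N` (`trunc_mem_of_valuativelyClosed`: for `z ∉ W`,
  `T_j = -∑_{i<j} aᵢ z^{i-j}`),
  and for `k` maximal with `v(a_k) = 0` one has `v(T_k) = 0` and `z = (z T_k)/T_k` with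
  `z T_k = T_{k-1} - a_{k-1} ∈ N` (`exists_div_of_relation`).
* (`derivative_eval_mul_eq_eval_of_isIntegral`) **Euler's different formula** `f'(η) N ⊆ O_L[η]`
  (Mathlib's `traceForm_dualSubmodule_adjoin` over the integrally closed `O_L` with fraction field
  `L`, traces of integral elements being integral).

## Sources

* [KK09] H. Knaf, F.-V. Kuhlmann, *Every place admits local uniformization in a finite extension
  of the function field*, Adv. Math. 221 (2009) 428–453 = arXiv:math/0702856, Lemma 3.7 (p. 13 of
  the 19-page arXiv text) and the proof of Prop. 3.10 (p. 14).
* [KK05] H. Knaf, F.-V. Kuhlmann, *Abhyankar places admit local uniformization in any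
  characteristic*, Ann. Sci. ÉNS 38 (2005) 833–846 = arXiv:math/0304159, §5 (p. 12 of the 16-page
  arXiv text: the standard-étale algebra `O_E[x]_{g(x)}` and "Claim: … we can assume `f` to be
  prime").
* [K8] F.-V. Kuhlmann, *Elimination of ramification II: Henselian rationality*, Israel J. Math.
  234 (2019) 927–958 = arXiv:1701.05508, proof of Prop. 6.1 (p. 14: "it is generated by a henselian
  element `η` …, that is, the coefficients of its minimal polynomial `h` over `K'(T)` lie in the
  valuation ring of `K'(T)`, and `vh'(η) = 0`").
* [Ray] M. Raynaud, *Anneaux locaux henséliens*, LNM 169 (1970), Ch. X Thm. 1 (cited by [KK09],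
  [KK05] for the local-étale structure; not used here).

## Rendering notes

Ambient rendering of `ValuedFunctionFields.lean`: `(Ω, V)` a valued field, `L : Subfield Ω`,
`O_L = V.toSubring ⊓ L.toSubring`, `L(η) = Subfield.closure (L ∪ {η})`; polynomials "over `O_L`"
are polynomials over `Ω` with coefficients in `V ∩ L`; "`f` is the minimal polynomial of `η` over
`L`" = `f` monic over `O_L` with `f(η) = 0` and of least degree among the non-zero polynomials over
`L` vanishing at `η` (the form used by `KnafKuhlmann2005_Thm34_etale`); values are multiplicative
(`V.valuation`, units have value `1`).
-/

noncomputable section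

namespace Literature.AlgebraicGeometry.Resolution

universe u

open Polynomial

section Pruefer

variable {Ω : Type u} [Field Ω] {V : ValuationSubring Ω} {L F : Subfield Ω} {N : Subring Ω}

/-! Throughout this section `N ⊆ V ∩ F` is a subring which is *valuatively closed in `F`*: an
element of `F` lying in every valuation ring `W ⊇ N` of `Ω` lies in `N` (hypothesis `hN`). The
structure theorem uses `N :=` the elements of `F` lying in every valuation ring containing
`O_L = V ∩ L`, i.e. the integral closure of `O_L` in `F` (Chevalley). -/

/-! ### Truncations of an algebraic relation -/

/-- **Truncation lemma**: if `∑_{i ≤ n} aᵢ uⁱ = 0` with `aᵢ ∈ N` and `u ∈ F`, then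
every truncation `T_j = ∑_{m ≤ n-j} a_{j+m} u^m` lies in `N` (for a valuation ring `W ⊇ O_L`:
if `u ∈ W` this is clear, otherwise `u⁻¹ ∈ W` and `T_j = -∑_{i<j} aᵢ u^{i-j} ∈ W`). [folklore] -/
theorem trunc_mem_of_valuativelyClosed (hNF : N ≤ F.toSubring)
    (hN : ∀ x ∈ F, (∀ W : ValuationSubring Ω, N ≤ W.toSubring → x ∈ W) → x ∈ N)
    {n : ℕ} {a : ℕ → Ω} {u : Ω} (huF : u ∈ F) (ha : ∀ i ≤ n, a i ∈ N)
    (hrel : ∑ i ∈ Finset.range (n + 1), a i * u ^ i = 0) {j : ℕ} (hj : j ≤ n) :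
    ∑ m ∈ Finset.range (n + 1 - j), a (j + m) * u ^ m ∈ N := by
  refine hN _ (sum_mem fun m hm => mul_mem (hNF (ha (j + m) ?_)) (pow_mem huF m)) ?_
  · have := Finset.mem_range.mp hm; omega
  intro W hW
  have haW : ∀ i ≤ n, a i ∈ W := fun i hi => hW (ha i hi)
  by_cases huW : u ∈ W
  · refine sum_mem fun m hm => mul_mem (haW (j + m) ?_) (pow_mem huW m)
    have := Finset.mem_range.mp hm; omega
  · have hu0 : u ≠ 0 := fun h => huW (h ▸ W.zero_mem)
    have huiW : u⁻¹ ∈ W := (W.mem_or_inv_mem u).resolve_left huW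
    -- split the relation at `j`
    have hsplit : ∑ i ∈ Finset.range (n + 1), a i * u ^ i =
        ∑ i ∈ Finset.range j, a i * u ^ i +
          u ^ j * ∑ m ∈ Finset.range (n + 1 - j), a (j + m) * u ^ m := by
      rw [show Finset.range (n + 1) = Finset.range (j + (n + 1 - j)) by congr 1; omega,
        Finset.sum_range_add, Finset.mul_sum]
      congr 1
      refine Finset.sum_congr rfl fun m _ => ?_
      rw [pow_add]; ring
    rw [hrel] at hsplit
    have hT : ∑ m ∈ Finset.range (n + 1 - j), a (j + m) * u ^ m =
        -∑ i ∈ Finset.range j, a i * (u⁻¹) ^ (j - i) := by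
      have hne : u ^ j ≠ 0 := pow_ne_zero j hu0
      have h1 : u ^ j * ∑ m ∈ Finset.range (n + 1 - j), a (j + m) * u ^ m =
          -∑ i ∈ Finset.range j, a i * u ^ i := by
        linear_combination hsplit.symm
      have h2 : ∑ m ∈ Finset.range (n + 1 - j), a (j + m) * u ^ m =
          (u ^ j)⁻¹ * -∑ i ∈ Finset.range j, a i * u ^ i := by
        rw [← h1, ← mul_assoc, inv_mul_cancel₀ hne, one_mul]
      rw [h2, mul_neg, Finset.mul_sum]
      congr 1
      refine Finset.sum_congr rfl fun i hi => ?_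
      have hij : i ≤ j := (Finset.mem_range.mp hi).le
      have hsplitpow : u ^ j = u ^ i * u ^ (j - i) := by rw [← pow_add, Nat.add_sub_cancel' hij]
      rw [hsplitpow, inv_pow]
      field_simp
    rw [hT]
    exact neg_mem (sum_mem fun i hi => mul_mem (haW i (by
      have := Finset.mem_range.mp hi; omega)) (pow_mem huiW _))

/-! ### The dominant truncation has value `1` -/

/-- If `v(u) ≤ 1`, all `v(aᵢ) ≤ 1`, `v(a_k) = 1` and `v(aᵢ) < 1` for `i > k`, then the truncation
`T_k = a_k + a_{k+1} u + ⋯` has value `1`. [folklore] -/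
theorem valuation_trunc_eq_one {n k : ℕ} {a : ℕ → Ω} {u : Ω} (hk : k ≤ n)
    (hu : V.valuation u ≤ 1) (haV : ∀ i ≤ n, V.valuation (a i) ≤ 1)
    (hak : V.valuation (a k) = 1) (hmax : ∀ i, k < i → i ≤ n → V.valuation (a i) < 1) :
    V.valuation (∑ m ∈ Finset.range (n + 1 - k), a (k + m) * u ^ m) = 1 := by
  have : n + 1 - k = (n - k) + 1 := by omega
  rw [this, Finset.sum_range_succ']
  simp only [pow_zero, mul_one, add_zero]
  have hsmall : V.valuation (∑ m ∈ Finset.range (n - k), a (k + (m + 1)) * u ^ (m + 1)) < 1 := by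
    refine Valuation.map_sum_lt _ one_ne_zero fun m hm => ?_
    have hm' := Finset.mem_range.mp hm
    rw [map_mul, map_pow]
    have hpow : V.valuation u ^ (m + 1) ≤ 1 := pow_le_one₀ zero_le hu
    calc V.valuation (a (k + (m + 1))) * V.valuation u ^ (m + 1)
        ≤ V.valuation (a (k + (m + 1))) * 1 := by gcongr
      _ = V.valuation (a (k + (m + 1))) := mul_one _
      _ < 1 := hmax _ (by omega) (by omega)
  have haV' := haV k hk
  rw [Valuation.map_add_eq_of_lt_right _ (by rw [hak]; exact hsmall), hak]

/-! ### Elements of `V ∩ F` are quotients of integral elements -/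

/-- **The Prüfer property of the integral closure of a valuation ring**, elementwise: if `u ∈ F`
with `v(u) ≤ 1` satisfies `∑_{i ≤ n} aᵢ uⁱ = 0` with `aᵢ ∈ N` (integral elements) and some
`v(a_k) = 1`, then `u = x/s` with `x, s ∈ N`, `v(s) = 1`: take `k` maximal with `v(a_k) = 1` and
`s := T_k`, `x := u T_k = T_{k-1} - a_{k-1}`. [folklore] -/
theorem exists_div_of_relation (hNV : N ≤ V.toSubring) (hNF : N ≤ F.toSubring)
    (hN : ∀ x ∈ F, (∀ W : ValuationSubring Ω, N ≤ W.toSubring → x ∈ W) → x ∈ N)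
    {n : ℕ} {a : ℕ → Ω} {u : Ω} (huF : u ∈ F) (hu : V.valuation u ≤ 1) (ha : ∀ i ≤ n, a i ∈ N)
    (hunit : ∃ k ≤ n, V.valuation (a k) = 1)
    (hrel : ∑ i ∈ Finset.range (n + 1), a i * u ^ i = 0) :
    ∃ x ∈ N, ∃ s ∈ N, V.valuation s = 1 ∧ u = x / s := by
  classical
  have haV : ∀ i ≤ n, V.valuation (a i) ≤ 1 := fun i hi =>
    (V.valuation_le_one_iff _).mpr (hNV (ha i hi))
  -- the maximal index with unit coefficient
  let S : Finset ℕ := (Finset.range (n + 1)).filter fun i => V.valuation (a i) = 1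
  have hSne : S.Nonempty := by
    obtain ⟨k, hk, hak⟩ := hunit
    exact ⟨k, Finset.mem_filter.mpr ⟨Finset.mem_range.mpr (by omega), hak⟩⟩
  set k := S.max' hSne with hkdef
  have hkS : k ∈ S := Finset.max'_mem S hSne
  have hk : k ≤ n := by
    have := Finset.mem_range.mp (Finset.mem_filter.mp hkS).1; omega
  have hak : V.valuation (a k) = 1 := (Finset.mem_filter.mp hkS).2
  have hmax : ∀ i, k < i → i ≤ n → V.valuation (a i) < 1 := by
    intro i hki hin
    refine lt_of_le_of_ne (haV i hin) fun heq => ?_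
    have hiS : i ∈ S := Finset.mem_filter.mpr ⟨Finset.mem_range.mpr (by omega), heq⟩
    exact absurd (Finset.le_max' S i hiS) (by rw [← hkdef]; omega)
  have hTk := valuation_trunc_eq_one hk hu haV hak hmax
  -- `k = 0` is impossible
  have hk0 : k ≠ 0 := by
    intro hk0
    rw [hk0] at hTk
    simp only [Nat.sub_zero, zero_add] at hTk
    rw [hrel, map_zero] at hTk
    exact zero_ne_one hTk
  -- `s := T_k`, `x := u T_k = T_{k-1} - a_{k-1}`
  set s := ∑ m ∈ Finset.range (n + 1 - k), a (k + m) * u ^ m with hsdef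
  have hsN : s ∈ N := trunc_mem_of_valuativelyClosed hNF hN huF ha hrel hk
  have hTk1 : ∑ m ∈ Finset.range (n + 1 - (k - 1)), a (k - 1 + m) * u ^ m ∈ N :=
    trunc_mem_of_valuativelyClosed hNF hN huF ha hrel (by omega)
  have hxs : u * s = ∑ m ∈ Finset.range (n + 1 - (k - 1)), a (k - 1 + m) * u ^ m - a (k - 1) := by
    have : n + 1 - (k - 1) = (n + 1 - k) + 1 := by omega
    rw [this, Finset.sum_range_succ', hsdef, Finset.mul_sum]
    simp only [pow_zero, mul_one, add_zero, add_sub_cancel_right]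
    refine Finset.sum_congr rfl fun m _ => ?_
    have : k - 1 + (m + 1) = k + m := by omega
    rw [this, pow_succ]; ring
  have hxN : u * s ∈ N := by
    rw [hxs]
    exact sub_mem hTk1 (ha (k - 1) (by omega))
  have hs0 : s ≠ 0 := fun h0 => by rw [h0, map_zero] at hTk; exact zero_ne_one hTk
  exact ⟨u * s, hxN, s, hsN, hTk, by field_simp⟩

/-- **An algebraic relation with a unit coefficient**: every `u` algebraic over the subfield `L`
satisfies `∑_{i ≤ n} aᵢ uⁱ = 0` with `aᵢ ∈ O_L = V ∩ L` and some `a_k = 1` (divide a relation over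
`L` by a coefficient of maximal value). [folklore] -/
theorem exists_relation_of_isAlgebraic {u : Ω} (halg : IsAlgebraic L u) :
    ∃ (n : ℕ) (a : ℕ → Ω), (∀ i, a i ∈ V ∧ a i ∈ L) ∧ (∃ k ≤ n, V.valuation (a k) = 1) ∧
      ∑ i ∈ Finset.range (n + 1), a i * u ^ i = 0 := by
  classical
  obtain ⟨p, hp0, hpu⟩ := halg
  let c : ℕ → Ω := fun i => ((p.coeff i : L) : Ω)
  have hsupp : p.support.Nonempty :=
    Finset.nonempty_iff_ne_empty.mpr fun h => hp0 (Polynomial.support_eq_empty.mp h)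
  obtain ⟨k, hk, hkmax⟩ := Finset.exists_max_image p.support (fun i => V.valuation (c i)) hsupp
  have hck0 : c k ≠ 0 := by
    have := Polynomial.mem_support_iff.mp hk
    exact fun h => this (Subtype.ext h)
  have hvck0 : V.valuation (c k) ≠ 0 := (_root_.map_ne_zero _).mpr hck0
  refine ⟨p.natDegree, fun i => c i / c k, fun i => ⟨?_, div_mem (p.coeff i).2 (p.coeff k).2⟩,
    ⟨k, Polynomial.le_natDegree_of_mem_supp k hk, by simp only; rw [div_self hck0, map_one]⟩, ?_⟩
  · refine (V.valuation_le_one_iff _).mp ?_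
    rw [map_div₀]
    by_cases hi : i ∈ p.support
    · exact div_le_one_of_le₀ (hkmax i hi) zero_le
    · have : c i = 0 := by
        have := Polynomial.notMem_support_iff.mp hi
        simp only [c, this, ZeroMemClass.coe_zero]
      rw [this, map_zero, zero_div]; exact zero_le
  · have hsum : ∑ i ∈ Finset.range (p.natDegree + 1), c i * u ^ i = 0 := by
      rw [Polynomial.aeval_eq_sum_range] at hpu
      rw [← hpu]
      refine Finset.sum_congr rfl fun i _ => ?_
      rw [Algebra.smul_def]; rfl
    calc ∑ i ∈ Finset.range (p.natDegree + 1), c i / c k * u ^ i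
        = (c k)⁻¹ * ∑ i ∈ Finset.range (p.natDegree + 1), c i * u ^ i := by
          rw [Finset.mul_sum]
          refine Finset.sum_congr rfl fun i _ => ?_
          rw [div_eq_inv_mul]; ring
      _ = 0 := by rw [hsum, mul_zero]

/-- **The valuation rings of an algebraic extension are localisations of the integral closure**
(Bourbaki, *Algèbre commutative* VI §8 no. 6; elementwise, valuative form): if every element of the
subfield `F ⊇ L` is algebraic over `L` and `N ⊆ V ∩ F` is a subring containing `O_L = V ∩ L` and
valuatively closed in `F`, then every `z ∈ V ∩ F` is `x/s` with `x, s ∈ N` and `v(s) = 1`.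
[folklore] -/
theorem exists_div_of_valuativelyClosed (hF : ∀ u ∈ F, IsAlgebraic L u)
    (hNV : N ≤ V.toSubring) (hNF : N ≤ F.toSubring) (hON : V.toSubring ⊓ L.toSubring ≤ N)
    (hN : ∀ x ∈ F, (∀ W : ValuationSubring Ω, N ≤ W.toSubring → x ∈ W) → x ∈ N)
    {z : Ω} (hzF : z ∈ F) (hzV : z ∈ V) :
    ∃ x ∈ N, ∃ s ∈ N, V.valuation s = 1 ∧ z = x / s := by
  obtain ⟨n, a, haOL, hunit, hrel⟩ := exists_relation_of_isAlgebraic (V := V) (hF z hzF)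
  have ha : ∀ i ≤ n, a i ∈ N := fun i _ => hON ⟨(haOL i).1, (haOL i).2⟩
  exact exists_div_of_relation hNV hNF hN hzF ((V.valuation_le_one_iff z).mpr hzV) ha hunit hrel

end Pruefer

section Euler

variable {Ω : Type u} [Field Ω]


/-- A polynomial over `Ω` with coefficients in a subfield `L` lifts to `L[X]`. [folklore] -/
theorem exists_polynomial_map_eq_of_coeff_mem_subfield (L : Subfield Ω) (P : Polynomial Ω)
    (hP : ∀ k, P.coeff k ∈ L) :
    ∃ Q : Polynomial L, Q.map (algebraMap L Ω) = P ∧ (P.Monic → Q.Monic) := by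
  have hl : P ∈ Polynomial.lifts (algebraMap L Ω) :=
    (Polynomial.lifts_iff_coeff_lifts P).mpr fun k => ⟨⟨P.coeff k, hP k⟩, rfl⟩
  by_cases hmon : P.Monic
  · obtain ⟨Q, hQ, -, hQm⟩ := Polynomial.lifts_and_degree_eq_and_monic hl hmon
    exact ⟨Q, hQ, fun _ => hQm⟩
  · obtain ⟨Q, hQ⟩ := (Polynomial.mem_lifts P).mp hl
    exact ⟨Q, hQ, fun h => (hmon h).elim⟩

/-- **Euler's different formula, valuation-ring form**: let `f` be a monic polynomial over
`O_L = V ∩ L`, of least degree among the non-zero polynomials over `L` vanishing at `η` (so `f` is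
the minimal polynomial of `η` over `L`), with `f'(η) ≠ 0`. Then for every `z ∈ L(η)` integral over
`O_L`, `f'(η) z ∈ O_L[η]`. Proof: `L(η)|L` is finite separable with power basis `1, η, …`; the
trace dual of `O_L[η]` is `f'(η)⁻¹ O_L[η]` (Euler; Mathlib's `traceForm_dualSubmodule_adjoin`, the
integrally closed domain `O_L` having fraction field `L`), and an `O_L`-integral `z` lies in that
dual because traces of integral elements are integral. [folklore] -/
theorem derivative_eval_mul_eq_eval_of_isIntegral (V : ValuationSubring Ω) (L : Subfield Ω) {η : Ω}
    {f : Polynomial Ω} (hf : ∀ k, f.coeff k ∈ V ∧ f.coeff k ∈ L) (hfmon : f.Monic)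
    (hfη : f.eval η = 0)
    (hfirr : ∀ P : Polynomial Ω, (∀ k, P.coeff k ∈ L) → P ≠ 0 → P.eval η = 0 →
      f.natDegree ≤ P.natDegree)
    (hder : (derivative f).eval η ≠ 0) {z : Ω}
    (hzF : z ∈ Subfield.closure ((L : Set Ω) ∪ {η}))
    (hzint : IsIntegral ↥(V.toSubring ⊓ L.toSubring) z) :
    ∃ a : Polynomial Ω, (∀ k, a.coeff k ∈ V ∧ a.coeff k ∈ L) ∧
      (derivative f).eval η * z = a.eval η := by
  classical
  set O : Subring Ω := V.toSubring ⊓ L.toSubring with hO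
  -- `f` over `L`: the minimal polynomial of `η`, separable
  obtain ⟨fL, hfL, hmon⟩ := exists_polynomial_map_eq_of_coeff_mem_subfield L f fun k => (hf k).2
  have hfLmon : fL.Monic := hmon hfmon
  have hLinj : Function.Injective (algebraMap L Ω) := (algebraMap L Ω).injective
  have hfLη : aeval η fL = 0 := by rw [aeval_def, eval₂_eq_eval_map, hfL]; exact hfη
  have hint : IsIntegral L η := ⟨fL, hfLmon, by rw [eval₂_eq_eval_map, hfL]; exact hfη⟩
  have hmin : fL = minpoly L η := by
    refine minpoly.unique' L η hfLmon hfLη fun q hq => ?_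
    by_cases hq0 : q = 0
    · exact Or.inl hq0
    · refine Or.inr fun hq' => ?_
      have hqL : ∀ k, (q.map (algebraMap L Ω)).coeff k ∈ L := fun k => by
        rw [coeff_map]; exact (q.coeff k).2
      have hq'0 : q.map (algebraMap L Ω) ≠ 0 := (Polynomial.map_ne_zero_iff hLinj).mpr hq0
      have hev : (q.map (algebraMap L Ω)).eval η = 0 := by
        rw [← eval₂_eq_eval_map, ← aeval_def]; exact hq'
      have h1 := hfirr _ hqL hq'0 hev
      rw [natDegree_map_eq_of_injective hLinj, ← hfL, natDegree_map_eq_of_injective hLinj] at h1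
      exact absurd (natDegree_lt_natDegree hq0 hq) (not_lt.mpr h1)
  have hderL : derivative fL ≠ 0 := by
    intro h0
    apply hder
    have : (derivative fL).map (algebraMap L Ω) = derivative f := by
      rw [← derivative_map, hfL]
    rw [← this, h0, Polynomial.map_zero, eval_zero]
  have hsep : IsSeparable L η := by
    change (minpoly L η).Separable
    rw [← hmin]
    exact (separable_iff_derivative_ne_zero (hmin ▸ minpoly.irreducible hint)).mpr hderL
  -- the tower `O → L → L(η)`
  let Kx : IntermediateField L Ω := IntermediateField.adjoin L ({η} : Set Ω)
  let φ : O →+* L :=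
    { toFun := fun r => ⟨r, r.2.2⟩
      map_one' := rfl
      map_mul' := fun _ _ => rfl
      map_zero' := rfl
      map_add' := fun _ _ => rfl }
  letI : Algebra O L := φ.toAlgebra
  letI : Algebra O Kx := ((algebraMap L Kx).comp φ).toAlgebra
  haveI : IsScalarTower O L Kx := IsScalarTower.of_algebraMap_eq (fun _ => rfl)
  haveI : IsScalarTower O Kx Ω := IsScalarTower.of_algebraMap_eq (fun _ => rfl)
  haveI : FaithfulSMul O L := (faithfulSMul_iff_algebraMap_injective O L).mpr
    (fun a b h => Subtype.ext (congrArg (fun t : L => (t : Ω)) h))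
  haveI : IsFractionRing O L := by
    refine IsFractionRing.of_field O L fun w => ?_
    by_cases hw : (w : Ω) ∈ V
    · exact ⟨⟨w, hw, w.2⟩, 1, by simp; rfl⟩
    · have hwi : (w : Ω)⁻¹ ∈ V := (V.mem_or_inv_mem _).resolve_left hw
      refine ⟨1, ⟨(w : Ω)⁻¹, hwi, L.inv_mem w.2⟩, ?_⟩
      apply Subtype.ext
      change (w : Ω) = ((1 : L) : Ω) / (w : Ω)⁻¹
      simp
  haveI : IsIntegrallyClosed O := isIntegrallyClosed_inf V L
  haveI : FiniteDimensional L Kx := IntermediateField.adjoin.finiteDimensional hint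
  haveI : Algebra.IsSeparable L Kx :=
    (IntermediateField.isSeparable_adjoin_simple_iff_isSeparable (F := L) (E := Ω)).mpr hsep
  let gen : Kx := IntermediateField.AdjoinSimple.gen L η
  have hgen : (gen : Ω) = η := rfl
  have hx : Algebra.adjoin L {gen} = ⊤ := by
    have := (IntermediateField.adjoin.powerBasis hint).adjoin_gen_eq_top
    simpa using this
  -- integrality of `gen` over `O`
  obtain ⟨fO, hfO, hmonO⟩ := exists_map_eq_of_coeff_mem_subring O f fun k => ⟨(hf k).1, (hf k).2⟩
  let ι : Kx →ₐ[O] Ω := IsScalarTower.toAlgHom O Kx Ω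
  have hι : Function.Injective ι := fun a b h => Subtype.ext h
  have hηint : IsIntegral O η :=
    ⟨fO, hmonO hfmon, by rw [eval₂_eq_eval_map, hfO]; exact hfη⟩
  have hAx : IsIntegral O gen := (isIntegral_algHom_iff ι hι).mp hηint
  have hdual := traceForm_dualSubmodule_adjoin O L hx hAx
  -- `z` lies in the trace dual of `O[gen]`
  have hzKx : z ∈ Kx := (mem_adjoin_subfield_iff L {η} z).mpr hzF
  set z' : Kx := ⟨z, hzKx⟩ with hz'
  have hz'int : IsIntegral O z' := (isIntegral_algHom_iff ι hι).mp hzint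
  have hz'dual : z' ∈ (Algebra.traceForm L Kx).dualSubmodule
      (Subalgebra.toSubmodule (Algebra.adjoin O {gen})) := by
    rw [LinearMap.BilinForm.mem_dualSubmodule]
    intro y hy
    rw [Algebra.traceForm_apply]
    have hyint : IsIntegral O y := by
      have hle : Algebra.adjoin O {gen} ≤ integralClosure O Kx :=
        Algebra.adjoin_le (Set.singleton_subset_iff.mpr ((mem_integralClosure_iff _ _).mpr hAx))
      exact (mem_integralClosure_iff _ _).mp (hle hy)
    have htr : IsIntegral O (Algebra.trace L Kx (z' * y)) :=
      Algebra.isIntegral_trace (hz'int.mul hyint)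
    obtain ⟨r, hr⟩ := IsIntegrallyClosed.isIntegral_iff.mp htr
    exact Submodule.mem_one.mpr ⟨r, hr⟩
  rw [hdual] at hz'dual
  obtain ⟨b, hb, hbz⟩ := (Submodule.mem_smul_pointwise_iff_exists _ _ _).mp hz'dual
  have hb' : b ∈ Algebra.adjoin O {gen} := hb
  rw [Algebra.adjoin_singleton_eq_range_aeval] at hb'
  obtain ⟨q, hq⟩ := hb'
  refine ⟨q.map (algebraMap O Ω), fun k => ?_, ?_⟩
  · rw [coeff_map]; exact ⟨(q.coeff k).2.1, (q.coeff k).2.2⟩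
  -- compare in `Ω`
  set c : Kx := aeval gen (derivative (minpoly L gen)) with hc
  have hc0 : c ≠ 0 :=
    (Algebra.IsSeparable.isSeparable L gen).aeval_derivative_ne_zero (minpoly.aeval _ _)
  have hcval : (c : Ω) = (derivative f).eval η := by
    have h1 : (c : Ω) = aeval η (derivative (minpoly L gen)) := by
      rw [hc, ← hgen]
      exact (aeval_algHom_apply (IntermediateField.val Kx) gen _).symm
    rw [h1, IntermediateField.minpoly_gen, ← hmin, aeval_def, eval₂_eq_eval_map, ← derivative_map, hfL]
  have hbval : (b : Ω) = (q.map (algebraMap O Ω)).eval η := by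
    rw [← hq, eval_map, ← aeval_def, ← hgen]
    exact (aeval_algHom_apply ι gen q).symm
  have hzb : (c : Ω)⁻¹ * b = z := by
    have := congrArg (fun t : Kx => (t : Ω)) hbz
    simpa using this
  rw [← hbval, ← hcval, ← hzb, ← mul_assoc, mul_inv_cancel₀ (by
    exact_mod_cast hc0 : (c : Ω) ≠ 0), one_mul]


end Euler

/-! ## The structure theorem -/

section Main

variable {Ω : Type u} [Field Ω]

/-- **`O_{L(η)} = (O_L[η])_q` for an inertial generator** (the structure behind Knaf–Kuhlmann
2009, Lemma 3.7 (2), (3) and Knaf–Kuhlmann 2005, §5: "`O_F = A_q` for an étale `O_E`-algebra `A`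
[…] `A = O_E[x]_{g(x)}`"): let `f` be monic over `O_L = V ∩ L`, of least degree among the non-zero
polynomials over `L` vanishing at `η`, with `v(f'(η)) = 1` (a unit). Then every `z ∈ V ∩ L(η)` is
`a(η)/b(η)` with `a, b` polynomials over `O_L` and `v(b(η)) = 1`. Proof: `z = x/s` with `x, s`
integral over `O_L`, `v(s) = 1` (`exists_div_of_valuativelyClosed`), and
`f'(η)x, f'(η)s ∈ O_L[η]` (`derivative_eval_mul_eq_eval_of_isIntegral`).
[cite: KnafKuhlmann2009, Lemma 3.7] -/
theorem exists_div_of_valuation_derivative_eq_one (V : ValuationSubring Ω) (L : Subfield Ω)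
    {η : Ω} {f : Polynomial Ω} (hf : ∀ k, f.coeff k ∈ V ∧ f.coeff k ∈ L) (hfmon : f.Monic)
    (hfη : f.eval η = 0)
    (hfirr : ∀ P : Polynomial Ω, (∀ k, P.coeff k ∈ L) → P ≠ 0 → P.eval η = 0 →
      f.natDegree ≤ P.natDegree)
    (hder : V.valuation ((derivative f).eval η) = 1) {z : Ω}
    (hzF : z ∈ Subfield.closure ((L : Set Ω) ∪ {η})) (hzV : z ∈ V) :
    ∃ a b : Polynomial Ω, (∀ k, a.coeff k ∈ V ∧ a.coeff k ∈ L) ∧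
      (∀ k, b.coeff k ∈ V ∧ b.coeff k ∈ L) ∧ V.valuation (b.eval η) = 1 ∧
      z = a.eval η / b.eval η := by
  set F : Subfield Ω := Subfield.closure ((L : Set Ω) ∪ {η}) with hFdef
  have hLF : L ≤ F := fun c hc => Subfield.subset_closure (Or.inl hc)
  -- `η`, hence every element of `F`, is algebraic over `L`
  obtain ⟨fL, hfL, hmon⟩ := exists_polynomial_map_eq_of_coeff_mem_subfield L f fun k => (hf k).2
  have hηint : IsIntegral L η := ⟨fL, hmon hfmon, by rw [eval₂_eq_eval_map, hfL]; exact hfη⟩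
  have hηalg : IsAlgebraic L η := hηint.isAlgebraic
  have hF : ∀ u ∈ F, IsAlgebraic L u := fun u hu =>
    isAlgebraic_of_mem_closure (s := {η}) (fun x hx => by rw [Set.mem_singleton_iff.mp hx]; exact hηalg) hu
  have hder0 : (derivative f).eval η ≠ 0 := fun h0 => by
    rw [h0, map_zero] at hder; exact zero_ne_one hder
  -- `N :=` the elements of `F` lying in every valuation ring containing `O_L`
  set O : Subring Ω := V.toSubring ⊓ L.toSubring with hOdef
  set N : Subring Ω := F.toSubring ⊓ ⨅ W : {W : ValuationSubring Ω // O ≤ W.toSubring},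
    W.1.toSubring with hNdef
  have hmemN : ∀ x, x ∈ N ↔ x ∈ F ∧ ∀ W : ValuationSubring Ω, O ≤ W.toSubring → x ∈ W := by
    intro x
    rw [hNdef, Subring.mem_inf, Subring.mem_iInf]
    exact ⟨fun ⟨h1, h2⟩ => ⟨h1, fun W hW => h2 ⟨W, hW⟩⟩, fun ⟨h1, h2⟩ => ⟨h1, fun W => h2 W.1 W.2⟩⟩
  have hNV : N ≤ V.toSubring := fun x hx => ((hmemN x).mp hx).2 V inf_le_left
  have hNF : N ≤ F.toSubring := fun x hx => ((hmemN x).mp hx).1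
  have hON : O ≤ N := fun x hx => (hmemN x).mpr ⟨hLF hx.2, fun W hW => hW hx⟩
  have hN : ∀ x ∈ F, (∀ W : ValuationSubring Ω, N ≤ W.toSubring → x ∈ W) → x ∈ N :=
    fun x hxF hx => (hmemN x).mpr ⟨hxF, fun W hW => hx W fun y hy => ((hmemN y).mp hy).2 W hW⟩
  -- elements of `N` are integral over `O_L` (Chevalley)
  have hNint : ∀ x ∈ N, IsIntegral O x := by
    intro x hx
    by_contra h
    have hx' : x ∉ (integralClosure O Ω).toSubring := fun h' =>
      h ((mem_integralClosure_iff _ _).mp h')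
    obtain ⟨W, hW, hxW⟩ := Subring.exists_le_valuationSubring_of_isIntegrallyClosedIn hx'
    refine hxW (((hmemN x).mp hx).2 W fun c hc => hW ?_)
    exact (mem_integralClosure_iff _ _).mpr (isIntegral_algebraMap (x := (⟨c, hc⟩ : O)))
  -- `z = x / s` with `x, s ∈ N`, `v(s) = 1`
  obtain ⟨x, hxN, s, hsN, hvs, rfl⟩ := exists_div_of_valuativelyClosed hF hNV hNF hON hN hzF hzV
  obtain ⟨a, ha, hax⟩ := derivative_eval_mul_eq_eval_of_isIntegral V L hf hfmon hfη hfirr hder0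
    (hNF hxN) (hNint x hxN)
  obtain ⟨b, hb, hbs⟩ := derivative_eval_mul_eq_eval_of_isIntegral V L hf hfmon hfη hfirr hder0
    (hNF hsN) (hNint s hsN)
  refine ⟨a, b, ha, hb, ?_, ?_⟩
  · rw [← hbs, map_mul, hder, hvs, one_mul]
  · rw [← hax, ← hbs, mul_div_mul_left x s hder0]

end Main

end Literature.AlgebraicGeometry.Resolution

end
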